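import Summits.AnomalousDissipation.AnomalousDissipation.Theorems.SolenoidalFractalHomogenisationLagrangianStepSidebandDefsFrame
import Summits.AnomalousDissipation.AnomalousDissipation.Theorems.SolenoidalFractalHomogenisationLagrangianStepSidebandSymbol
import HarnessLib

/-!
# K1L_D `LagrangianRenormalisationStepDesign` (stmt-AnomalousDissipation-27980), registered stub `stub_D1_V0thg` (v28, ruling D28-3 (3)), port-map layer L4:
# the SYMBOL of the frozen-frame exact effective map `psiStarθ`: `4π²·(1/ν)·T_{psiStarθᵀ}(k) z = Σ_{j j'} (êⱼ·k)(ê_{j'}·k) · (Re M^θ_{jj'}) z`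
# (helper; `--supports stmt-AnomalousDissipation-27980 --as helper`)

Summits-side helper file of route `SolenoidalFractalHomogenisation` (prover seat `ad-k1l-cellLawV-w1` g9; port map
`Cruxes/LagrangianRenormalisationStepDesign/Lines/onelevel-vtheta-twist-portmap.md` §3 L4, ruling D28-7).  The frozen-frame twin of `…SidebandSymbol`: the
polarisations `êⱼ` read by the symbol are flat; only the period-mean feedback matrices are twisted (`meanFeedbackθ`, definition `psiStarθ` of `…SidebandDefsFrame`).
Everything proved; no definitions, no named facts, no sorry.
* `symb_majorTranspose_psiStarθ_entry` — for `ν > 0`: `Σ_{a,b} (psiStarθᵀ) l a i b · k_a k_b = (ν/(4π²)) · Σ_{j,j'} (êⱼ·k)(ê_{j'}·k) · Re((M^θ_{jj'} e_l)_i)`;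
* **`symbT_majorTranspose_psiStarθ_apply`** — `(T_{(psiStarθ W M hM ν S G₀)ᵀ}(k) z)_i = Σ_l [(ν/(4π²)) Σ_{j,j'} (êⱼ·k)(ê_{j'}·k) Re((M^θ_{jj'} e_l)_i)] · z_l`;
* `symbT_majorTranspose_psiStarθ_of_not_pos` — off `ν > 0` the symbol vanishes.
At `G₀ = 1` these are literally the flat statements (`psiStarθ_one`, `meanFeedbackθ_one`).
NOT a proof of any registered stub, of the crux, or of anomalous dissipation; rung F-D1 infrastructure for the `stub_D1_V0thg` engine (L5 `…SidebandXEffGenPsiStarFrame`, L6c).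
-/

set_option linter.dupNamespace false

noncomputable section

namespace Summit.AnomalousDissipation.AnomalousDissipation.Theorems.SolenoidalFractalHomogenisation.LagrangianStep.Sideband

open Set MeasureTheory Complex UnitAddTorus
open scoped InnerProductSpace
open Literature.Analysis Literature.Analysis.FunctionSpaces Literature.Analysis.FunctionSpaces.Torus
open Literature.Analysis.FluidPDE Literature.Analysis.FluidPDE.Torus Literature.Analysis.FluidPDE.LatticeShear

variable {k₀ : ℕ}

/-- **The matrix entries of the symbol of the exact effective map** (`ν > 0`): for every integer wave vector `k` and `i l : Fin 3`,
`Σ_{a,b} (psiStarᵀ) l a i b · k_a k_b = (ν/(4π²)) · Σ_{j,j'} (êⱼ·k)(ê_{j'}·k) · Re((M_{jj'} e_l)_i)`. [cite: MajdaKramer1999, §2.2.1.3 (55)] -/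
theorem symb_majorTranspose_psiStarθ_entry (W : LatticeWord k₀) (M : ℝ) (hM : 0 < M) {ν : ℝ} (hν : 0 < ν) (S : Torus.Visc4 (Fin 3))
    (G₀ : Matrix (Fin 3) (Fin 3) ℝ) (k : Fin 3 → ℤ) (i l : Fin 3) :
    ∑ a, ∑ b, ((Torus.majorTranspose (psiStarθ W M hM ν S G₀) l a i b * (k a : ℝ) * (k b : ℝ) : ℝ) : ℂ) =
      ((ν / (4 * Real.pi ^ 2) : ℝ) : ℂ) * ∑ j : Fin k₀, ∑ j' : Fin k₀,
        ((∑ a, (((W.stretch M hM).stretch (1 / ν) (one_div_pos.mpr hν)).phase j).e a * (k a : ℝ) : ℝ) : ℂ) *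
        ((∑ b, (((W.stretch M hM).stretch (1 / ν) (one_div_pos.mpr hν)).phase j').e b * (k b : ℝ) : ℝ) : ℂ) *
        ((((meanFeedbackθ ((W.stretch M hM).stretch (1 / ν) (one_div_pos.mpr hν)) (ν • S) G₀ 1 (R0 ν) j j'
          (EuclideanSpace.single l (1:ℂ))) i).re : ℝ) : ℂ) := by
  -- opaque abbreviations
  obtain ⟨e, he⟩ : ∃ e : Fin k₀ → Fin 3 → ℝ, ∀ j a, (((W.stretch M hM).stretch (1 / ν) (one_div_pos.mpr hν)).phase j).e a = e j a :=
    ⟨_, fun _ _ => rfl⟩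
  obtain ⟨m, hm⟩ : ∃ m : Fin k₀ → Fin k₀ → ℝ, ∀ j j',
      ((meanFeedbackθ ((W.stretch M hM).stretch (1 / ν) (one_div_pos.mpr hν)) (ν • S) G₀ 1 (R0 ν) j j' (EuclideanSpace.single l (1:ℂ))) i).re = m j j' :=
    ⟨_, fun _ _ => rfl⟩
  have hΨ : ∀ a b : Fin 3, Torus.majorTranspose (psiStarθ W M hM ν S G₀) l a i b = ν / (4 * Real.pi ^ 2) * ∑ j : Fin k₀, ∑ j' : Fin k₀,
      e j' b * e j a * m j j' := fun a b => by
    rw [Torus.majorTranspose_apply, psiStarθ_of_pos W M hM hν S G₀]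
    simp only [he, hm]
  simp only [hΨ, he, hm]
  push_cast
  set C : ℂ := (ν : ℂ) / (4 * (Real.pi : ℂ) ^ 2) with hC
  -- both sides as the same fourfold sum
  have hL : ∑ a, ∑ b, C * (∑ j, ∑ j', (e j' b : ℂ) * (e j a : ℂ) * (m j j' : ℂ)) * (k a : ℂ) * (k b : ℂ) =
      ∑ a, ∑ b, ∑ j, ∑ j', C * (e j' b : ℂ) * (e j a : ℂ) * (m j j' : ℂ) * (k a : ℂ) * (k b : ℂ) := by
    refine Finset.sum_congr rfl fun a _ => Finset.sum_congr rfl fun b _ => ?_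
    rw [Finset.mul_sum, Finset.sum_mul, Finset.sum_mul]
    refine Finset.sum_congr rfl fun j _ => ?_
    rw [Finset.mul_sum, Finset.sum_mul, Finset.sum_mul]
    refine Finset.sum_congr rfl fun j' _ => ?_
    ring
  have hR : C * ∑ j, ∑ j', (∑ a, (e j a : ℂ) * (k a : ℂ)) * (∑ b, (e j' b : ℂ) * (k b : ℂ)) * (m j j' : ℂ) =
      ∑ j, ∑ j', ∑ a, ∑ b, C * (e j' b : ℂ) * (e j a : ℂ) * (m j j' : ℂ) * (k a : ℂ) * (k b : ℂ) := by
    rw [Finset.mul_sum]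
    refine Finset.sum_congr rfl fun j _ => ?_
    rw [Finset.mul_sum]
    refine Finset.sum_congr rfl fun j' _ => ?_
    rw [Finset.sum_mul_sum, Finset.sum_mul, Finset.mul_sum]
    refine Finset.sum_congr rfl fun a _ => ?_
    rw [Finset.sum_mul, Finset.mul_sum]
    refine Finset.sum_congr rfl fun b _ => ?_
    ring
  rw [hL, hR]
  -- rearrangement of the fourfold finite sum
  calc ∑ a, ∑ b, ∑ j, ∑ j', C * (e j' b : ℂ) * (e j a : ℂ) * (m j j' : ℂ) * (k a : ℂ) * (k b : ℂ)
      = ∑ a, ∑ j, ∑ b, ∑ j', C * (e j' b : ℂ) * (e j a : ℂ) * (m j j' : ℂ) * (k a : ℂ) * (k b : ℂ) :=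
        Finset.sum_congr rfl fun a _ => Finset.sum_comm
    _ = ∑ j, ∑ a, ∑ b, ∑ j', C * (e j' b : ℂ) * (e j a : ℂ) * (m j j' : ℂ) * (k a : ℂ) * (k b : ℂ) := Finset.sum_comm
    _ = ∑ j, ∑ a, ∑ j', ∑ b, C * (e j' b : ℂ) * (e j a : ℂ) * (m j j' : ℂ) * (k a : ℂ) * (k b : ℂ) :=
        Finset.sum_congr rfl fun j _ => Finset.sum_congr rfl fun a _ => Finset.sum_comm
    _ = ∑ j, ∑ j', ∑ a, ∑ b, C * (e j' b : ℂ) * (e j a : ℂ) * (m j j' : ℂ) * (k a : ℂ) * (k b : ℂ) := Finset.sum_congr rfl fun j _ => Finset.sum_comm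

/-- **The symbol of the exact effective map, matrix–vector form** (`ν > 0`):
`(T_{psiStarᵀ}(k) z)_i = Σ_l [(ν/(4π²)) Σ_{j j'} (êⱼ·k)(ê_{j'}·k) Re((M_{jj'} e_l)_i)] · z_l` — the modal generator of `(c/ν)•Ψ` at the slow mode is the
period-mean feedback operator `Σ_{jj'} (êⱼ·ℓ)(ê_{j'}·ℓ) Re M_{jj'}`. [cite: MajdaKramer1999, §2.2.1.3 (55)] [cite: Frisch1995Turbulence, §9.6.3 eq. (9.57) p. 233] -/
theorem symbT_majorTranspose_psiStarθ_apply (W : LatticeWord k₀) (M : ℝ) (hM : 0 < M) {ν : ℝ} (hν : 0 < ν) (S : Torus.Visc4 (Fin 3))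
    (G₀ : Matrix (Fin 3) (Fin 3) ℝ) (k : Fin 3 → ℤ) (z : EuclideanSpace ℂ (Fin 3)) (i : Fin 3) :
    Torus.symbT (Torus.majorTranspose (psiStarθ W M hM ν S G₀)) k z i =
      ∑ l, (((ν / (4 * Real.pi ^ 2) : ℝ) : ℂ) * ∑ j : Fin k₀, ∑ j' : Fin k₀,
        ((∑ a, (((W.stretch M hM).stretch (1 / ν) (one_div_pos.mpr hν)).phase j).e a * (k a : ℝ) : ℝ) : ℂ) *
        ((∑ b, (((W.stretch M hM).stretch (1 / ν) (one_div_pos.mpr hν)).phase j').e b * (k b : ℝ) : ℝ) : ℂ) *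
        ((((meanFeedbackθ ((W.stretch M hM).stretch (1 / ν) (one_div_pos.mpr hν)) (ν • S) G₀ 1 (R0 ν) j j'
          (EuclideanSpace.single l (1:ℂ))) i).re : ℝ) : ℂ)) * z l := by
  rw [Torus.symbT_apply]
  refine Finset.sum_congr rfl fun l _ => ?_
  rw [← symb_majorTranspose_psiStarθ_entry W M hM hν S G₀ k i l, Finset.sum_mul]
  refine Finset.sum_congr rfl fun a _ => ?_
  rw [Finset.sum_mul]

/-- Off `ν > 0` the symbol of `psiStar` vanishes. [cite: MajdaKramer1999, §2.2.1.3] -/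
theorem symbT_majorTranspose_psiStarθ_of_not_pos (W : LatticeWord k₀) (M : ℝ) (hM : 0 < M) {ν : ℝ} (hν : ¬ 0 < ν) (S : Torus.Visc4 (Fin 3))
    (G₀ : Matrix (Fin 3) (Fin 3) ℝ) (k : Fin 3 → ℤ) (z : EuclideanSpace ℂ (Fin 3)) : Torus.symbT (Torus.majorTranspose (psiStarθ W M hM ν S G₀)) k z = 0 := by
  ext i
  rw [Torus.symbT_apply, psiStarθ_of_not_pos W M hM hν S G₀]
  simp

end Summit.AnomalousDissipation.AnomalousDissipation.Theorems.SolenoidalFractalHomogenisation.LagrangianStep.Sideband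

end
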